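import Summits.QuantumFields.YangMills.Theorems.FluctuationComparisonRegPrIntLOrganTangentTelescopeWindowPath
import HarnessLib

/-!
# THE MIXED (SECOND-DIFFERENCE) TELESCOPE ALONG TWO WINDOW PATHS, def-free — the bilinear twin of brick «T»
# (✓p797413 `…OrganTangentTelescopeWindowPath`, first differences along ONE path) in the same H-currency

Cell `ym3-torus` (YM ladder rung R3 = continuum `SU(2)` Yang–Mills on the three-torus — a RUNG, NOT d = 4, NOT infinite volume, NOT a mass
gap, NOT Clay).  Width seat `ym3-torus-px20` (gen 17); `--supports stmt-QuantumFields-20520 --as helper`, count-neutral, definition-free,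
default heartbeats; no registry, binder or `Lines/` edit (registered skeleton `Lines/semiclassical_s2beta.lean` v11.4, 0∕5, untouched).

WHAT THIS IS.  Brick T transports a FIRST-difference bound along ONE path of moves from the scaled one-bond-pair clause `hH` (O1ᵘ-H's
`HClauseSq` currency).  The LINᵘ-H side of LEAD-20520 w3 g25's BRICK 2 («chart-response transport of an H-clause») needs the SECOND (mixed)
difference of `f` along TWO multi-bond moves — a base path `q` and a probe path `p` applied on top — bounded by the double sum of the clause's
column entries.  This file proves the two telescopes that do it, abstractly and for the organ's right exponential one-bond moves:

* §1 ABSTRACT (state space `X`, indices `ι`, moves `M`, action `act`, size `sz`, brick T's clause `hH` VERBATIM):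
  ★ `secondDiff_probe_path` — ONE probe move `(b, m)` ON TOP versus a BASE PATH `q`:
    `|f (act (q·U) b m) − f (q·U) − f (act U b m) + f U| ≤ (Σ_{(c,n) ∈ q} k c b · sz n) · sz m`,
    NO commutation hypothesis (every telescope cell is a clause square with the probe applied last; it is the SIGNED sharpening of brick T's
    `firstDiff_telescope`, whose anchor form forgets the base first difference);
  ★ `secondDiff_path_move_of_comm` — a probe PATH `p` on top versus ONE base move `(c, n)` that commutes with every move of `p`;
  ★★ `secondDiff_path_path_of_comm` — probe PATH `p` on top versus base PATH `q` under
    `hcomm : ∀ a ∈ p, ∀ c ∈ q, ∀ Y, act (act Y c.1 c.2) a.1 a.2 = act (act Y a.1 a.2) c.1 c.2`: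
    `|f (p·(q·U)) − f (q·U) − f (p·U) + f U| ≤ Σ_{(c,n) ∈ q} Σ_{(a,m) ∈ p} k c a · sz n · sz m`
    (the double telescope: outer over `q`, inner over `p`; the commutation presents each cell as a clause square);
  WINDOWED `_on` editions of all three (clause assumed only on `Good` squares with moves of size `≤ ρ`; hypotheses = every grid configuration
  `(p.take i)·((q.take j)·U)` is `Good`, every move window-size) — the shape of brick T's `firstDiff_telescope_on`.
* §2 THE ORGAN'S INSTANCE (`GaugeField P j SU(2)`, moves `U ↦ update U b (U b * expPt v)`, sizes `‖v‖∕θ`, window `PlaqSmall θ`, cap `r`,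
  the relational `HClauseSq` text `h` carried VERBATIM via brick T's ✓`clause_update_of_HClauseSq`):
  `move_comm_of_ne` (moves at DISTINCT bonds commute — each move reads only its own bond), ★ `secondDiff_window_path_probe` (§1 (A)),
  ★★ `secondDiff_window_paths_disjoint` (§1 (B) for bond-DISJOINT paths).

KNOWN LIMIT (not typed here): for paths SHARING a bond the telescope cell at that bond is still a clause square, but with the CONJUGATED
probe parameter (`E⁻¹·expPt v·E = expPt (Ad v)`), which costs a factor in `‖·‖` and in the cap; that edition belongs to BRICK 2's design.
Convention for `k`'s arguments throughout: `k (base bond) (probe bond) · sz (base move) · sz (probe move)` — the clause is applied with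
the base move FIRST and the probe move on top, exactly as brick T's `firstDiff_step`.

HONEST: [folklore] telescoping algebra over a HYPOTHESIS clause; nothing of Bałaban's is asserted or proved; LINᵘ-H, JENᵘ-H, O1ᵘ-H v2, S3ᴴ,
crux 20520, `YM3TorusSU2` NOT proved; no summit is proved by a telescope.  R3 = SU(2) YM₃ on T³ — NOT d = 4, NOT infinite volume, NOT a
mass gap, NOT Clay; the Yang–Mills mass gap is NOT proved.  Sorry-free, axioms standard.
[cite: Balaban1985UV3, p.263 (c) and (41) p.266; Balaban1985Variational, Thm 1 (9)-(10) p.279]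
-/

set_option autoImplicit false

noncomputable section

open Function
open Literature.MathematicalPhysics.QuantumFieldTheory.Balaban1983to89
open T4CubeChartExp (expPt)
open Summit.QuantumFields.YangMills.Theorems.OrganTangentTelescopeWindowPath (clause_update_of_HClauseSq)

namespace Summit.QuantumFields.YangMills.Theorems.OrganTangentTelescopeWindowPathMixed

/-! ## §0 One inequality used in every telescope step -/

/-- `|y| ≤ A`, `|z| ≤ B`, `y + z = x` ⟹ `|x| ≤ A + B`. [folklore] -/
theorem abs_le_of_add_eq {y z A B : ℝ} (hy : |y| ≤ A) (hz : |z| ≤ B) {x : ℝ} (h : y + z = x) : |x| ≤ A + B :=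
  h ▸ (abs_add_le y z).trans (add_le_add hy hz)

/-! ## §1 Abstract mixed telescopes -/

section Abstract

variable {X ι M : Type*}

/-- ★ (A) ONE PROBE ON TOP versus a BASE PATH: the mixed difference of `f` between the probe move `(b, m)` and the whole base path `q` is
bounded by the sum of the clause's column entries along `q` times the probe size — NO commutation hypothesis (each cell of the telescope
is a clause square with the probe applied last).  Convention `k (base) (probe)`. [folklore] -/
theorem secondDiff_probe_path (act : X → ι → M → X) (sz : M → ℝ) (f : X → ℝ) (k : ι → ι → ℝ)
    (hH : ∀ (U : X) (b b' : ι) (m m' : M),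
      |f (act (act U b m) b' m') - f (act U b m) - f (act U b' m') + f U| ≤ k b b' * sz m * sz m')
    (b : ι) (m : M) :
    ∀ (q : List (ι × M)) (U : X),
      |f (act (q.foldl (fun V s => act V s.1 s.2) U) b m) - f (q.foldl (fun V s => act V s.1 s.2) U) - f (act U b m) + f U|
        ≤ (q.map (fun s => k s.1 b * sz s.2)).sum * sz m := by
  intro q
  induction q with
  | nil =>
    intro U
    have h0 : f (act U b m) - f U - f (act U b m) + f U = 0 := by ring
    simp only [List.foldl_nil, List.map_nil, List.sum_nil, zero_mul, h0, abs_zero, le_refl]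
  | cons c cs ih =>
    intro U
    rw [List.foldl_cons]
    refine (abs_le_of_add_eq (ih (act U c.1 c.2)) (hH U c.1 b c.2 m) ?_).trans_eq ?_
    · ring
    · simp only [List.map_cons, List.sum_cons]; ring

/-- ★ (A′) A PROBE PATH ON TOP versus ONE BASE MOVE `(c, n)` commuting with every probe move: the mixed difference is bounded by the sum over
the probe path of `k c a · sz n · sz m`.  Convention `k (base) (probe)`. [folklore] -/
theorem secondDiff_path_move_of_comm (act : X → ι → M → X) (sz : M → ℝ) (f : X → ℝ) (k : ι → ι → ℝ)
    (hH : ∀ (U : X) (b b' : ι) (m m' : M),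
      |f (act (act U b m) b' m') - f (act U b m) - f (act U b' m') + f U| ≤ k b b' * sz m * sz m')
    (c : ι) (n : M) :
    ∀ (p : List (ι × M)) (U : X),
      (∀ a ∈ p, ∀ Y : X, act (act Y c n) a.1 a.2 = act (act Y a.1 a.2) c n) →
      |f (p.foldl (fun V s => act V s.1 s.2) (act U c n)) - f (act U c n) - f (p.foldl (fun V s => act V s.1 s.2) U) + f U|
        ≤ (p.map (fun s => k c s.1 * sz n * sz s.2)).sum := by
  intro p
  induction p with
  | nil =>
    intro U _
    have h0 : f (act U c n) - f (act U c n) - f U + f U = 0 := by ring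
    simp only [List.foldl_nil, List.map_nil, List.sum_nil, h0, abs_zero, le_refl]
  | cons a as ih =>
    intro U hcomm
    rw [List.foldl_cons, List.foldl_cons]
    have hca : act (act U c n) a.1 a.2 = act (act U a.1 a.2) c n := hcomm a (by simp) U
    have h2 := ih (act U a.1 a.2) (fun a' ha' Y => hcomm a' (List.mem_cons_of_mem a ha') Y)
    rw [← hca] at h2
    refine (abs_le_of_add_eq h2 (hH U c a.1 n a.2) ?_).trans_eq ?_
    · ring
    · simp only [List.map_cons, List.sum_cons]; ring

/-- ★★ (B) THE DOUBLE (BILINEAR) TELESCOPE: a probe PATH `p` on top versus a base PATH `q`, every probe move commuting with every base move: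
`|f (p·(q·U)) − f (q·U) − f (p·U) + f U| ≤ Σ_{(c,n) ∈ q} Σ_{(a,m) ∈ p} k c a · sz n · sz m`.  Convention `k (base) (probe)`. [folklore] -/
theorem secondDiff_path_path_of_comm (act : X → ι → M → X) (sz : M → ℝ) (f : X → ℝ) (k : ι → ι → ℝ)
    (hH : ∀ (U : X) (b b' : ι) (m m' : M),
      |f (act (act U b m) b' m') - f (act U b m) - f (act U b' m') + f U| ≤ k b b' * sz m * sz m')
    (p : List (ι × M)) :
    ∀ (q : List (ι × M)) (U : X),
      (∀ a ∈ p, ∀ c ∈ q, ∀ Y : X, act (act Y c.1 c.2) a.1 a.2 = act (act Y a.1 a.2) c.1 c.2) →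
      |f (p.foldl (fun V s => act V s.1 s.2) (q.foldl (fun V s => act V s.1 s.2) U)) - f (q.foldl (fun V s => act V s.1 s.2) U)
        - f (p.foldl (fun V s => act V s.1 s.2) U) + f U|
        ≤ (q.map (fun t => (p.map (fun s => k t.1 s.1 * sz t.2 * sz s.2)).sum)).sum := by
  intro q
  induction q with
  | nil =>
    intro U _
    have h0 : f (p.foldl (fun V s => act V s.1 s.2) U) - f U - f (p.foldl (fun V s => act V s.1 s.2) U) + f U = 0 := by ring
    simp only [List.foldl_nil, List.map_nil, List.sum_nil, h0, abs_zero, le_refl]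
  | cons c cs ih =>
    intro U hcomm
    rw [List.foldl_cons]
    have h1 := secondDiff_path_move_of_comm act sz f k hH c.1 c.2 p U (fun a ha Y => hcomm a ha c (by simp) Y)
    have h2 := ih (act U c.1 c.2) (fun a ha c' hc' Y => hcomm a ha c' (List.mem_cons_of_mem c hc') Y)
    refine (abs_le_of_add_eq h2 h1 ?_).trans_eq ?_
    · ring
    · simp only [List.map_cons, List.sum_cons, add_comm]

/-- ★ (A, WINDOWED) one probe on top versus a base path, the clause assumed only on `Good` squares with window-size moves: hypotheses =
every prefix of `q` applied to `U` and its `(b, m)`-excitation are `Good`, every move of `q` and the probe window-size. [folklore] -/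
theorem secondDiff_probe_path_on (Good : X → Prop) (ρ : ℝ) (act : X → ι → M → X) (sz : M → ℝ) (f : X → ℝ) (k : ι → ι → ℝ)
    (hH : ∀ (U : X) (b b' : ι) (m m' : M), Good U → Good (act U b m) → Good (act U b' m') → Good (act (act U b m) b' m') →
      sz m ≤ ρ → sz m' ≤ ρ → |f (act (act U b m) b' m') - f (act U b m) - f (act U b' m') + f U| ≤ k b b' * sz m * sz m')
    (b : ι) (m : M) (hm : sz m ≤ ρ) :
    ∀ (q : List (ι × M)) (U : X),
      (∀ s ∈ q, sz s.2 ≤ ρ) →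
      (∀ n ≤ q.length, Good ((q.take n).foldl (fun V s => act V s.1 s.2) U) ∧
        Good (act ((q.take n).foldl (fun V s => act V s.1 s.2) U) b m)) →
      |f (act (q.foldl (fun V s => act V s.1 s.2) U) b m) - f (q.foldl (fun V s => act V s.1 s.2) U) - f (act U b m) + f U|
        ≤ (q.map (fun s => k s.1 b * sz s.2)).sum * sz m := by
  intro q
  induction q with
  | nil =>
    intro U _ _
    have h0 : f (act U b m) - f U - f (act U b m) + f U = 0 := by ring
    simp only [List.foldl_nil, List.map_nil, List.sum_nil, zero_mul, h0, abs_zero, le_refl]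
  | cons c cs ih =>
    intro U hsz hgood
    have hg0 := hgood 0 (Nat.zero_le _)
    have hg1 := hgood 1 (by simp)
    simp only [List.take_zero, List.foldl_nil] at hg0
    simp only [List.take_succ_cons, List.take_zero, List.foldl_cons, List.foldl_nil] at hg1
    have h1 := hH U c.1 b c.2 m hg0.1 hg1.1 hg0.2 hg1.2 (hsz c (by simp)) hm
    have hgood' : ∀ n ≤ cs.length, Good ((cs.take n).foldl (fun V s => act V s.1 s.2) (act U c.1 c.2)) ∧
        Good (act ((cs.take n).foldl (fun V s => act V s.1 s.2) (act U c.1 c.2)) b m) := by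
      intro n hn
      have := hgood (n + 1) (by simpa using hn)
      simpa [List.take_succ_cons, List.foldl_cons] using this
    have h2 := ih (act U c.1 c.2) (fun s hs => hsz s (List.mem_cons_of_mem c hs)) hgood'
    rw [List.foldl_cons]
    refine (abs_le_of_add_eq h2 h1 ?_).trans_eq ?_
    · ring
    · simp only [List.map_cons, List.sum_cons]; ring

/-- ★ (A′, WINDOWED) a probe path `p` on top versus one commuting base move `(c, n)`: hypotheses = every prefix of `p` applied to `U` and to
`act U c n` is `Good`, all moves window-size. [folklore] -/
theorem secondDiff_path_move_of_comm_on (Good : X → Prop) (ρ : ℝ) (act : X → ι → M → X) (sz : M → ℝ) (f : X → ℝ)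
    (k : ι → ι → ℝ)
    (hH : ∀ (U : X) (b b' : ι) (m m' : M), Good U → Good (act U b m) → Good (act U b' m') → Good (act (act U b m) b' m') →
      sz m ≤ ρ → sz m' ≤ ρ → |f (act (act U b m) b' m') - f (act U b m) - f (act U b' m') + f U| ≤ k b b' * sz m * sz m')
    (c : ι) (n : M) (hn : sz n ≤ ρ) :
    ∀ (p : List (ι × M)) (U : X),
      (∀ a ∈ p, ∀ Y : X, act (act Y c n) a.1 a.2 = act (act Y a.1 a.2) c n) →
      (∀ s ∈ p, sz s.2 ≤ ρ) →
      (∀ i ≤ p.length, Good ((p.take i).foldl (fun V s => act V s.1 s.2) U) ∧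
        Good ((p.take i).foldl (fun V s => act V s.1 s.2) (act U c n))) →
      |f (p.foldl (fun V s => act V s.1 s.2) (act U c n)) - f (act U c n) - f (p.foldl (fun V s => act V s.1 s.2) U) + f U|
        ≤ (p.map (fun s => k c s.1 * sz n * sz s.2)).sum := by
  intro p
  induction p with
  | nil =>
    intro U _ _ _
    have h0 : f (act U c n) - f (act U c n) - f U + f U = 0 := by ring
    simp only [List.foldl_nil, List.map_nil, List.sum_nil, h0, abs_zero, le_refl]
  | cons a as ih =>
    intro U hcomm hsz hgood
    have hca : act (act U c n) a.1 a.2 = act (act U a.1 a.2) c n := hcomm a (by simp) U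
    have hg0 := hgood 0 (Nat.zero_le _)
    have hg1 := hgood 1 (by simp)
    simp only [List.take_zero, List.foldl_nil] at hg0
    simp only [List.take_succ_cons, List.take_zero, List.foldl_cons, List.foldl_nil] at hg1
    have h1 := hH U c a.1 n a.2 hg0.1 hg0.2 hg1.1 hg1.2 hn (hsz a (by simp))
    have hgood' : ∀ i ≤ as.length, Good ((as.take i).foldl (fun V s => act V s.1 s.2) (act U a.1 a.2)) ∧
        Good ((as.take i).foldl (fun V s => act V s.1 s.2) (act (act U a.1 a.2) c n)) := by
      intro i hi
      have := hgood (i + 1) (by simpa using hi)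
      rw [← hca]
      simpa [List.take_succ_cons, List.foldl_cons] using this
    have h2 := ih (act U a.1 a.2) (fun a' ha' Y => hcomm a' (List.mem_cons_of_mem a ha') Y)
      (fun s hs => hsz s (List.mem_cons_of_mem a hs)) hgood'
    rw [← hca] at h2
    rw [List.foldl_cons, List.foldl_cons]
    refine (abs_le_of_add_eq h2 h1 ?_).trans_eq ?_
    · ring
    · simp only [List.map_cons, List.sum_cons]; ring

/-- ★★ (B, WINDOWED) THE DOUBLE TELESCOPE with the clause assumed only on `Good` squares with window-size moves: hypotheses = every GRID
configuration `(p.take i)·((q.take j)·U)` is `Good`, all moves of `p` and `q` window-size, every probe move commutes with every base move.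
[folklore] -/
theorem secondDiff_path_path_of_comm_on (Good : X → Prop) (ρ : ℝ) (act : X → ι → M → X) (sz : M → ℝ) (f : X → ℝ)
    (k : ι → ι → ℝ)
    (hH : ∀ (U : X) (b b' : ι) (m m' : M), Good U → Good (act U b m) → Good (act U b' m') → Good (act (act U b m) b' m') →
      sz m ≤ ρ → sz m' ≤ ρ → |f (act (act U b m) b' m') - f (act U b m) - f (act U b' m') + f U| ≤ k b b' * sz m * sz m')
    (p : List (ι × M)) (hszp : ∀ s ∈ p, sz s.2 ≤ ρ) :
    ∀ (q : List (ι × M)) (U : X),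
      (∀ a ∈ p, ∀ c ∈ q, ∀ Y : X, act (act Y c.1 c.2) a.1 a.2 = act (act Y a.1 a.2) c.1 c.2) →
      (∀ t ∈ q, sz t.2 ≤ ρ) →
      (∀ i ≤ p.length, ∀ j ≤ q.length,
        Good ((p.take i).foldl (fun V s => act V s.1 s.2) ((q.take j).foldl (fun V s => act V s.1 s.2) U))) →
      |f (p.foldl (fun V s => act V s.1 s.2) (q.foldl (fun V s => act V s.1 s.2) U)) - f (q.foldl (fun V s => act V s.1 s.2) U)
        - f (p.foldl (fun V s => act V s.1 s.2) U) + f U|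
        ≤ (q.map (fun t => (p.map (fun s => k t.1 s.1 * sz t.2 * sz s.2)).sum)).sum := by
  intro q
  induction q with
  | nil =>
    intro U _ _ _
    have h0 : f (p.foldl (fun V s => act V s.1 s.2) U) - f U - f (p.foldl (fun V s => act V s.1 s.2) U) + f U = 0 := by ring
    simp only [List.foldl_nil, List.map_nil, List.sum_nil, h0, abs_zero, le_refl]
  | cons c cs ih =>
    intro U hcomm hszq hgood
    have hgood0 : ∀ i ≤ p.length, Good ((p.take i).foldl (fun V s => act V s.1 s.2) U) ∧
        Good ((p.take i).foldl (fun V s => act V s.1 s.2) (act U c.1 c.2)) := by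
      intro i hi
      refine ⟨?_, ?_⟩
      · have := hgood i hi 0 (Nat.zero_le _)
        simpa [List.take_zero, List.foldl_nil] using this
      · have := hgood i hi 1 (by simp)
        simpa [List.take_succ_cons, List.take_zero, List.foldl_cons, List.foldl_nil] using this
    have h1 := secondDiff_path_move_of_comm_on Good ρ act sz f k hH c.1 c.2 (hszq c (by simp)) p U
      (fun a ha Y => hcomm a ha c (by simp) Y) hszp hgood0
    have hgood' : ∀ i ≤ p.length, ∀ j ≤ cs.length,
        Good ((p.take i).foldl (fun V s => act V s.1 s.2) ((cs.take j).foldl (fun V s => act V s.1 s.2) (act U c.1 c.2))) := by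
      intro i hi j hj
      have := hgood i hi (j + 1) (by simpa using hj)
      simpa [List.take_succ_cons, List.foldl_cons] using this
    have h2 := ih (act U c.1 c.2) (fun a ha c' hc' Y => hcomm a ha c' (List.mem_cons_of_mem c hc') Y)
      (fun t ht => hszq t (List.mem_cons_of_mem c ht)) hgood'
    rw [List.foldl_cons]
    refine (abs_le_of_add_eq h2 h1 ?_).trans_eq ?_
    · ring
    · simp only [List.map_cons, List.sum_cons, add_comm]

end Abstract

/-! ## §2 The organ's instance: right exponential one-bond moves of `SU(2)` gauge fields -/

section Organ

variable {P : Params} {j : ℕ} [DecidableEq (PBond P j)]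

/-- Right exponential one-bond moves at DISTINCT bonds commute (each move reads only its own bond). [folklore] -/
theorem move_comm_of_ne {b b' : PBond P j} (hne : b ≠ b') (v v' : Fin 3 → ℝ)
    (U : GaugeField P j (Matrix.specialUnitaryGroup (Fin 2) ℂ)) :
    update (update U b (U b * expPt v)) b' ((update U b (U b * expPt v)) b' * expPt v')
      = update (update U b' (U b' * expPt v')) b ((update U b' (U b' * expPt v')) b * expPt v) := by
  rw [update_of_ne hne.symm, update_of_ne hne, update_comm hne]

/-- ★ **ONE PROBE ON TOP OF A WINDOW PATH** (§1 (A) for the organ): for the `HClauseSq` TEXT `h` (VERBATIM, as a hypothesis), a probe `(b, v)`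
(`‖v‖∕θ ≤ r`), a base path `q` of window-size moves all of whose prefixes applied to `U` (and their `b`-excitations) are `θ`-small:
`|R (probe (q·U)) − R (q·U) − R (probe U) + R U| ≤ (Σ_{(c,w) ∈ q} k c b·(‖w‖∕θ))·(‖v‖∕θ)` — no disjointness needed. [folklore] -/
theorem secondDiff_window_path_probe {θ r : ℝ} (hθ : 0 < θ) {k : PBond P j → PBond P j → ℝ}
    {R : GaugeField P j (Matrix.specialUnitaryGroup (Fin 2) ℂ) → ℝ}
    (h : ∀ (b b' : PBond P j) (v v' : Fin 3 → ℝ) (U V W Z : GaugeField P j (Matrix.specialUnitaryGroup (Fin 2) ℂ)),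
      ‖v‖ ≤ r * θ → ‖v'‖ ≤ r * θ → PlaqSmall θ U → PlaqSmall θ V → PlaqSmall θ W → PlaqSmall θ Z →
      (∀ e, e ≠ b → V e = U e) → V b = U b * expPt v → (∀ e, e ≠ b' → W e = U e) → W b' = U b' * expPt v' →
      (∀ e, e ≠ b' → Z e = V e) → Z b' = V b' * expPt v' →
      |R Z - R V - R W + R U| ≤ k b b' * (‖v‖ / θ) * (‖v'‖ / θ)) (b : PBond P j) (v : Fin 3 → ℝ) (hv : ‖v‖ / θ ≤ r)
    (q : List (PBond P j × (Fin 3 → ℝ))) (U : GaugeField P j (Matrix.specialUnitaryGroup (Fin 2) ℂ))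
    (hsz : ∀ s ∈ q, ‖s.2‖ / θ ≤ r)
    (hgood : ∀ n ≤ q.length,
      PlaqSmall θ ((q.take n).foldl (fun U s => update U s.1 (U s.1 * expPt s.2)) U) ∧
      PlaqSmall θ (update ((q.take n).foldl (fun U s => update U s.1 (U s.1 * expPt s.2)) U) b
        (((q.take n).foldl (fun U s => update U s.1 (U s.1 * expPt s.2)) U) b * expPt v))) :
    |R (update (q.foldl (fun U s => update U s.1 (U s.1 * expPt s.2)) U) b
        ((q.foldl (fun U s => update U s.1 (U s.1 * expPt s.2)) U) b * expPt v)) -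
      R (q.foldl (fun U s => update U s.1 (U s.1 * expPt s.2)) U) - R (update U b (U b * expPt v)) + R U|
      ≤ (q.map (fun s => k s.1 b * (‖s.2‖ / θ))).sum * (‖v‖ / θ) :=
  secondDiff_probe_path_on (PlaqSmall θ) r
    (fun (U : GaugeField P j (Matrix.specialUnitaryGroup (Fin 2) ℂ)) (b : PBond P j) (v : Fin 3 → ℝ) => update U b (U b * expPt v))
    (fun w : Fin 3 → ℝ => ‖w‖ / θ) R k (clause_update_of_HClauseSq hθ h) b v hv q U hsz hgood

/-- ★★ **THE MIXED DIFFERENCE ALONG TWO BOND-DISJOINT WINDOW PATHS** (§1 (B) for the organ): for the `HClauseSq` TEXT `h` (VERBATIM, as a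
hypothesis), a probe path `p` and a base path `q` touching DISJOINT bond sets, window-size moves, and every grid configuration
`(p.take i)·((q.take j)·U)` `θ`-small:
`|R (p·(q·U)) − R (q·U) − R (p·U) + R U| ≤ Σ_{(c,w) ∈ q} Σ_{(a,v) ∈ p} k c a·(‖w‖∕θ)·(‖v‖∕θ)`. [folklore] -/
theorem secondDiff_window_paths_disjoint {θ r : ℝ} (hθ : 0 < θ) {k : PBond P j → PBond P j → ℝ}
    {R : GaugeField P j (Matrix.specialUnitaryGroup (Fin 2) ℂ) → ℝ}
    (h : ∀ (b b' : PBond P j) (v v' : Fin 3 → ℝ) (U V W Z : GaugeField P j (Matrix.specialUnitaryGroup (Fin 2) ℂ)),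
      ‖v‖ ≤ r * θ → ‖v'‖ ≤ r * θ → PlaqSmall θ U → PlaqSmall θ V → PlaqSmall θ W → PlaqSmall θ Z →
      (∀ e, e ≠ b → V e = U e) → V b = U b * expPt v → (∀ e, e ≠ b' → W e = U e) → W b' = U b' * expPt v' →
      (∀ e, e ≠ b' → Z e = V e) → Z b' = V b' * expPt v' →
      |R Z - R V - R W + R U| ≤ k b b' * (‖v‖ / θ) * (‖v'‖ / θ))
    (p q : List (PBond P j × (Fin 3 → ℝ))) (U : GaugeField P j (Matrix.specialUnitaryGroup (Fin 2) ℂ))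
    (hdisj : ∀ a ∈ p, ∀ c ∈ q, a.1 ≠ c.1)
    (hszp : ∀ s ∈ p, ‖s.2‖ / θ ≤ r) (hszq : ∀ t ∈ q, ‖t.2‖ / θ ≤ r)
    (hgood : ∀ i ≤ p.length, ∀ n ≤ q.length,
      PlaqSmall θ ((p.take i).foldl (fun U s => update U s.1 (U s.1 * expPt s.2))
        ((q.take n).foldl (fun U s => update U s.1 (U s.1 * expPt s.2)) U))) :
    |R (p.foldl (fun U s => update U s.1 (U s.1 * expPt s.2)) (q.foldl (fun U s => update U s.1 (U s.1 * expPt s.2)) U)) -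
      R (q.foldl (fun U s => update U s.1 (U s.1 * expPt s.2)) U) -
      R (p.foldl (fun U s => update U s.1 (U s.1 * expPt s.2)) U) + R U|
      ≤ (q.map (fun t => (p.map (fun s => k t.1 s.1 * (‖t.2‖ / θ) * (‖s.2‖ / θ))).sum)).sum :=
  secondDiff_path_path_of_comm_on (PlaqSmall θ) r
    (fun (U : GaugeField P j (Matrix.specialUnitaryGroup (Fin 2) ℂ)) (b : PBond P j) (v : Fin 3 → ℝ) => update U b (U b * expPt v))
    (fun w : Fin 3 → ℝ => ‖w‖ / θ) R k (clause_update_of_HClauseSq hθ h) p hszp q U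
    (fun a ha c hc Y => (move_comm_of_ne (hdisj a ha c hc).symm c.2 a.2 Y)) hszq hgood

end Organ

end Summit.QuantumFields.YangMills.Theorems.OrganTangentTelescopeWindowPathMixed

end
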